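import Literature.Computability.Complexity.AOWAccepts
import Literature.Computability.Complexity.AOWListMatrix
import HarnessLib

/-!
# The AOW refuter as a list program, and its agreement with `aowRefute`

Trunk T-CPLX-CORE (Literature/Computability/Complexity). Support file for the machine form of the
Allen–O'Donnell–Witmer refuter (running-time third of the discharge of `allen_odonnell_witmer_kSAT`,
`AOWRefutation.lean`). The refuter `aowRefute k n φ` (`AOWAccepts.lean`) is specified on
`Matrix ([n]^a) ([n]^b) ℤ` and finite sums; a machine computes it on LISTS. This file writes the same
test as a program on lists of clauses and list matrices (`AOWListMatrix.lean`) and proves that the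
program IS the refuter (`refuteP_eq_aowRefute`); `AOWProgramFP.lean` then shows the program is
polynomial time on codes.

* clause level: `varAt`, `negAt`, `idxL n c P` (the number `∑ₜ x_{c[Pₜ]} nᵗ` of the scope restricted
  to the positions `P`, i.e. `finFunctionFinEquiv`), `sgnL c S` (`∏_{p∈S} ±1`), `wfB`/`parseL`
  (= `parseConstraints`, `parseL_eq`);
* level test: `bEnt`/`bMat` (the level matrix on `range (n^a) × range (n^b)`), `levelTraceP`,
  `LevelCheckP` with **`levelCheckP_iff`** (`↔ LevelCheck`), through `toMat_bMat` (the list matrix is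
  the re-indexed level matrix) and `trace_pow_gram_submatrix`;
* odd test: `wEnt`, `aEnt`/`aMat` (rows `range (N²)`, `N = n^r`, pairs by `finProdFinEquiv`),
  `oddTraceP`, `sqSumP`, `OddCheckP` with **`oddCheckP_iff`**;
* `AcceptsP`, `refuteP` and **`refuteP_eq_aowRefute`**.

## References

* S. R. Allen, R. O'Donnell, D. Witmer, *How to refute a random CSP*, FOCS 2015, arXiv:1505.04383,
  Thm. 2.3 and App. A ("an efficient algorithm": the tests are polynomial-time linear algebra).
* S. Arora, B. Barak, *Computational Complexity: A Modern Approach*, CUP 2009, §1.3.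
-/

namespace Literature.Computability.Complexity

namespace AOWProg

open Finset Matrix LMat

variable {k n : ℕ}

/-! ### Clauses: positions, scope numbers, signs, parsing -/

/-- The variable at position `p` of a clause (`0` past the end). [folklore] -/
def varAt (c : Clause ℕ) (p : ℕ) : ℕ := (c.getD p (0, false)).1

/-- The polarity at position `p` of a clause. [folklore] -/
def negAt (c : Clause ℕ) (p : ℕ) : Bool := (c.getD p (0, false)).2

/-- **The scope number** of a clause on the positions `P`: `∑ₜ x_{c[Pₜ]} · nᵗ` (Horner).
[Allen–O'Donnell–Witmer 2015, App. A.1 (rows/columns `[n]^{|U|}`)] [folklore] -/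
def idxL (n : ℕ) (c : Clause ℕ) : List ℕ → ℕ
  | [] => 0
  | p :: P => varAt c p + n * idxL n c P

/-- **The sign** of a clause on the positions `S`: `∏_{p ∈ S} (±1)^{c_p}`. [Allen–O'Donnell–Witmer
2015, proof of Lemma 4.3 (`c^S`)] [folklore] -/
def sgnL (c : Clause ℕ) : List ℕ → ℤ
  | [] => 1
  | p :: S => pmSign (negAt c p) * sgnL c S

/-- Well-formed clauses: exactly `k` literals, all on variables `< n`. [Allen–O'Donnell–Witmer 2015, Def. 3.1] [folklore] -/
def wfB (k n : ℕ) (c : Clause ℕ) : Bool := decide (c.length = k) && c.all fun l => decide (l.1 < n)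

/-- The parsed clauses (the program's `parseConstraints`). [folklore] -/
def parseL (k n : ℕ) (φ : CNF ℕ) : List (Clause ℕ) := φ.filter (wfB k n)

/-- Positions of a constraint's clause. [folklore] -/
theorem getD_toClause (C : AOWConstraint k n) (i : Fin k) :
    C.toClause.getD i (0, false) = ((C.1 i : ℕ), C.2 i) := by
  rw [AOWConstraint.toClause, List.getD_eq_getElem _ _ (by simp), List.getElem_ofFn]

/-- `varAt` of a constraint's clause. [folklore] -/
@[simp] theorem varAt_toClause (C : AOWConstraint k n) (i : Fin k) : varAt C.toClause i = C.1 i := by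
  rw [varAt, getD_toClause]

/-- `negAt` of a constraint's clause. [folklore] -/
@[simp] theorem negAt_toClause (C : AOWConstraint k n) (i : Fin k) : negAt C.toClause i = C.2 i := by
  rw [negAt, getD_toClause]

/-- Horner: the scope number of `ofFn g` is `∑ₜ varAt (g t) nᵗ`. [folklore] -/
theorem idxL_ofFn (n : ℕ) (c : Clause ℕ) : ∀ {a : ℕ} (g : Fin a → ℕ),
    idxL n c (List.ofFn g) = ∑ t : Fin a, varAt c (g t) * n ^ (t : ℕ)
  | 0, g => by simp [idxL]
  | a + 1, g => by
    rw [List.ofFn_succ, idxL, idxL_ofFn n c (fun i => g i.succ), Fin.sum_univ_succ, Finset.mul_sum]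
    simp only [Fin.val_zero, pow_zero, mul_one, Fin.val_succ, pow_succ]
    congr 1
    exact Finset.sum_congr rfl fun i _ => by ring

/-- **The scope number of a constraint is `finFunctionFinEquiv` of its restricted scope.** [folklore] -/
theorem idxL_toClause {a : ℕ} (C : AOWConstraint k n) (e : Fin a → Fin k) :
    idxL n C.toClause (List.ofFn fun t => (e t : ℕ)) = (finFunctionFinEquiv (C.1 ∘ e) : ℕ) := by
  rw [idxL_ofFn, finFunctionFinEquiv_apply]
  simp

/-- The sign of `ofFn g` is `∏ₜ ±1`. [folklore] -/
theorem sgnL_ofFn (c : Clause ℕ) : ∀ {s : ℕ} (g : Fin s → ℕ),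
    sgnL c (List.ofFn g) = ∏ t : Fin s, pmSign (negAt c (g t))
  | 0, g => by simp [sgnL]
  | s + 1, g => by
    rw [List.ofFn_succ, sgnL, sgnL_ofFn c (fun i => g i.succ), Fin.prod_univ_succ]

/-- **The sign of a constraint's clause on the positions of an injective `f` is `signAt C (image f)`.** [folklore] -/
theorem sgnL_toClause {s : ℕ} (C : AOWConstraint k n) (f : Fin s → Fin k) (hf : Function.Injective f) :
    sgnL C.toClause (List.ofFn fun t => (f t : ℕ)) = C.signAt (univ.image f) := by
  rw [sgnL_ofFn, AOWConstraint.signAt, Finset.prod_image fun i _ j _ h => hf h]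
  simp

/-- The parse condition. [folklore] -/
theorem wfB_eq (k n : ℕ) (c : Clause ℕ) : wfB k n c = decide (c.length = k ∧ ∀ l ∈ c, l.1 < n) := by
  simp only [wfB, Bool.decide_and, List.all_eq]
  congr 1
  simp

/-- **The program's parser is `parseConstraints`.** [folklore] -/
theorem parseL_eq (k n : ℕ) (φ : CNF ℕ) :
    parseL k n φ = (parseConstraints k n φ).map AOWConstraint.toClause := by
  induction φ with
  | nil => rfl
  | cons c φ ih =>
    simp only [parseL, parseConstraints] at ih ⊢
    rw [List.filter_cons, List.filterMap_cons]
    by_cases h : c.length = k ∧ ∀ l ∈ c, l.1 < n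
    · have hw : wfB k n c = true := by rw [wfB_eq]; exact decide_eq_true h
      have hsome : (AOWConstraint.ofClause? k n c).isSome := by
        unfold AOWConstraint.ofClause?; rw [dif_pos h]; rfl
      obtain ⟨C, hC⟩ := Option.isSome_iff_exists.1 hsome
      rw [hw, if_pos rfl, hC]
      change c :: List.filter (wfB k n) φ =
        AOWConstraint.toClause C :: (List.filterMap (AOWConstraint.ofClause? k n) φ).map AOWConstraint.toClause
      rw [AOWConstraint.toClause_eq_of_ofClause? hC, ih]
    · have hw : wfB k n c = false := by rw [wfB_eq]; exact decide_eq_false h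
      have hnone : AOWConstraint.ofClause? k n c = none := by
        unfold AOWConstraint.ofClause?; rw [dif_neg h]
      rw [hw, hnone, if_neg Bool.false_ne_true]
      exact ih

/-- The parsed list has the length of `parseConstraints`. [folklore] -/
theorem length_parseL (k n : ℕ) (φ : CNF ℕ) : (parseL k n φ).length = (parseConstraints k n φ).length := by
  rw [parseL_eq, List.length_map]

/-! ### The level test -/

section Level

variable {a b : ℕ}

/-- First-block positions of a split. [folklore] -/
def pos₁ (f : Fin (a + b) → Fin k) : List ℕ := List.ofFn fun t : Fin a => (f (Fin.castAdd b t) : ℕ)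

/-- Second-block positions of a split. [folklore] -/
def pos₂ (f : Fin (a + b) → Fin k) : List ℕ := List.ofFn fun t : Fin b => (f (Fin.natAdd a t) : ℕ)

/-- All positions of a split. [folklore] -/
def posS {s : ℕ} (f : Fin s → Fin k) : List ℕ := List.ofFn fun t : Fin s => (f t : ℕ)

/-- **Entries of the program's level matrix**: `B[x][y] = ∑_{c} [idx₁ c = x ∧ idx₂ c = y] · sgn c`.
[Allen–O'Donnell–Witmer 2015, App. A.1 (`B_{U₁,U₂}`)] [cite: arXiv150504383, App. A] -/
def bEnt (n : ℕ) (cs : List (Clause ℕ)) (P₁ P₂ S : List ℕ) (x y : ℕ) : ℤ :=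
  (cs.map fun c => if idxL n c P₁ = x ∧ idxL n c P₂ = y then sgnL c S else 0).sum

/-- The program's level matrix, `n^a × n^b`. [folklore] -/
def bMat (n a b : ℕ) (cs : List (Clause ℕ)) (P₁ P₂ S : List ℕ) : List (List ℤ) :=
  tab (n ^ a) (n ^ b) (bEnt n cs P₁ P₂ S)

/-- The program's trace `tr((BᵀB)^q)`. [folklore] -/
def levelTraceP (n a b q : ℕ) (cs : List (Clause ℕ)) (P₁ P₂ S : List ℕ) : ℤ :=
  traceL (n ^ b) (powL (n ^ b) (gramL (n ^ a) (n ^ b) (bMat n a b cs P₁ P₂ S)) q)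

/-- **The program's level test** (the inequality of `LevelCheck` with `q` for `2^j`). [cite: arXiv150504383, App. A] -/
def LevelCheckP (k n a b q m : ℕ) (cs : List (Clause ℕ)) (P₁ P₂ S : List ℕ) : Prop :=
  ((2 : ℤ) ^ k) ^ (2 * q) * (((n : ℤ) ^ a) ^ q * ((n : ℤ) ^ b) ^ q * levelTraceP n a b q cs P₁ P₂ S) <
    (m : ℤ) ^ (2 * q)

/-- `LevelCheckP` is decidable. [folklore] -/
instance (k n a b q m : ℕ) (cs : List (Clause ℕ)) (P₁ P₂ S : List ℕ) :
    Decidable (LevelCheckP k n a b q m cs P₁ P₂ S) := by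
  unfold LevelCheckP; infer_instance

/-- The per-constraint term of `bEnt` is the level entry at the decoded indices. [folklore] -/
theorem bEnt_term (C : AOWConstraint k n) (f : Fin (a + b) → Fin k) (hf : Function.Injective f)
    (x : Fin (n ^ a)) (y : Fin (n ^ b)) :
    (if idxL n C.toClause (pos₁ f) = x ∧ idxL n C.toClause (pos₂ f) = y then sgnL C.toClause (posS f) else 0) =
      levelEntry C (univ.image f) (f ∘ Fin.castAdd b) (f ∘ Fin.natAdd a)
        (finFunctionFinEquiv.symm x) (finFunctionFinEquiv.symm y) := by
  rw [levelEntry, pos₁, pos₂, posS, idxL_toClause, idxL_toClause, sgnL_toClause C f hf]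
  have h1 : ((finFunctionFinEquiv (C.1 ∘ fun t => f (Fin.castAdd b t)) : ℕ) = x) ↔
      finFunctionFinEquiv.symm x = C.1 ∘ (f ∘ Fin.castAdd b) := by
    rw [Equiv.symm_apply_eq, eq_comm, Fin.ext_iff]
    exact Iff.rfl
  have h2 : ((finFunctionFinEquiv (C.1 ∘ fun t => f (Fin.natAdd a t)) : ℕ) = y) ↔
      finFunctionFinEquiv.symm y = C.1 ∘ (f ∘ Fin.natAdd a) := by
    rw [Equiv.symm_apply_eq, eq_comm, Fin.ext_iff]
    exact Iff.rfl
  simp only [h1, h2]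

/-- **The program's level matrix is the re-indexed level matrix.** [folklore] -/
theorem toMat_bMat (L : List (AOWConstraint k n)) (f : Fin (a + b) → Fin k) (hf : Function.Injective f) :
    toMat (n ^ a) (n ^ b) (bMat n a b (L.map AOWConstraint.toClause) (pos₁ f) (pos₂ f) (posS f)) =
      (levelMatrix L (univ.image f) (f ∘ Fin.castAdd b) (f ∘ Fin.natAdd a)).submatrix
        finFunctionFinEquiv.symm finFunctionFinEquiv.symm := by
  rw [bMat, toMat_tab]
  funext x y
  rw [Matrix.submatrix_apply, levelMatrix, Matrix.of_apply, bEnt, List.map_map]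
  congr 1
  exact List.map_congr_left fun C _ => bEnt_term C f hf x y

/-- **The program's level test is `LevelCheck`.** [Allen–O'Donnell–Witmer 2015, App. A.1/A.4] [cite: arXiv150504383, App. A] -/
theorem levelCheckP_iff (L : List (AOWConstraint k n)) (f : Fin (a + b) → Fin k) (hf : Function.Injective f)
    (j : ℕ) :
    LevelCheckP k n a b (2 ^ j) L.length (L.map AOWConstraint.toClause) (pos₁ f) (pos₂ f) (posS f) ↔
      LevelCheck k n j L f := by
  unfold LevelCheckP LevelCheck levelTraceP
  rw [traceL_powL_gramL, toMat_bMat L f hf, trace_pow_gram_submatrix]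

end Level

/-! ### The odd test -/

section Odd

variable {r : ℕ}

/-- First-block positions of an odd split. [folklore] -/
def opos₁ (f : Fin (r + r + 1) → Fin k) : List ℕ := List.ofFn fun t : Fin r => (oddFst f t : ℕ)

/-- Second-block positions of an odd split. [folklore] -/
def opos₂ (f : Fin (r + r + 1) → Fin k) : List ℕ := List.ofFn fun t : Fin r => (oddSnd f t : ℕ)

/-- The last position of an odd split. [folklore] -/
def oposLast (f : Fin (r + r + 1) → Fin k) : ℕ := (oddLast f : ℕ)

/-- **Entries of the program's tensor** `w(x, y, l) = ∑_c [idx₁ c = x ∧ idx₂ c = y ∧ last c = l] · sgn c`.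
[Allen–O'Donnell–Witmer 2015, App. A.2] [cite: arXiv150504383, App. A.2] -/
def wEnt (n : ℕ) (cs : List (Clause ℕ)) (P₁ P₂ : List ℕ) (pl : ℕ) (S : List ℕ) (x y l : ℕ) : ℤ :=
  (cs.map fun c => if idxL n c P₁ = x ∧ idxL n c P₂ = y ∧ varAt c pl = l then sgnL c S else 0).sum

/-- **Entries of the program's odd matrix** on rows/columns `ρ, κ < N²` (`N = n^r`), pairs decoded by
`(ρ / N, ρ % N)`: (A-def) of Allen–O'Donnell–Witmer. [cite: arXiv150504383, App. A.2] -/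
def aEnt (n r : ℕ) (cs : List (Clause ℕ)) (P₁ P₂ : List ℕ) (pl : ℕ) (S : List ℕ) (ρ κ : ℕ) : ℤ :=
  if ρ / n ^ r = ρ % n ^ r ∧ κ / n ^ r = κ % n ^ r then 0
  else sumRange n fun l => wEnt n cs P₁ P₂ pl S (ρ / n ^ r) (κ / n ^ r) l *
    wEnt n cs P₁ P₂ pl S (ρ % n ^ r) (κ % n ^ r) l

/-- The program's odd matrix, `N² × N²`. [folklore] -/
def aMat (n r : ℕ) (cs : List (Clause ℕ)) (P₁ P₂ : List ℕ) (pl : ℕ) (S : List ℕ) : List (List ℤ) :=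
  tab (n ^ r * n ^ r) (n ^ r * n ^ r) (aEnt n r cs P₁ P₂ pl S)

/-- The program's odd trace `tr((AᵀA)^q)`. [folklore] -/
def oddTraceP (n r q : ℕ) (cs : List (Clause ℕ)) (P₁ P₂ : List ℕ) (pl : ℕ) (S : List ℕ) : ℤ :=
  traceL (n ^ r * n ^ r) (powL (n ^ r * n ^ r)
    (gramL (n ^ r * n ^ r) (n ^ r * n ^ r) (aMat n r cs P₁ P₂ pl S)) q)

/-- The program's sum of squares `∑ w²`. [folklore] -/
def sqSumP (n r : ℕ) (cs : List (Clause ℕ)) (P₁ P₂ : List ℕ) (pl : ℕ) (S : List ℕ) : ℤ :=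
  sumRange (n ^ r) fun x => sumRange (n ^ r) fun y => sumRange n fun l => wEnt n cs P₁ P₂ pl S x y l ^ 2

/-- **The program's odd test** (the two inequalities of `OddCheck` with `q` for `2^j`). [cite: arXiv150504383, App. A.2] -/
def OddCheckP (k n r q m : ℕ) (cs : List (Clause ℕ)) (P₁ P₂ : List ℕ) (pl : ℕ) (S : List ℕ) : Prop :=
  (2 * 4 ^ k * (n : ℤ)) ^ (2 * q) *
        ((((n : ℤ) ^ r) ^ 2) ^ q * (((n : ℤ) ^ r) ^ 2) ^ q * oddTraceP n r q cs P₁ P₂ pl S) <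
      ((m : ℤ) ^ 2) ^ (2 * q) ∧
    2 * 4 ^ k * (n : ℤ) * sqSumP n r cs P₁ P₂ pl S < (m : ℤ) ^ 2

/-- `OddCheckP` is decidable. [folklore] -/
instance (k n r q m : ℕ) (cs : List (Clause ℕ)) (P₁ P₂ : List ℕ) (pl : ℕ) (S : List ℕ) :
    Decidable (OddCheckP k n r q m cs P₁ P₂ pl S) := by
  unfold OddCheckP; infer_instance

/-- **The program's tensor is the odd tensor at the decoded indices.** [folklore] -/
theorem wEnt_eq (L : List (AOWConstraint k n)) (f : Fin (r + r + 1) → Fin k) (hf : Function.Injective f)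
    (x y : Fin (n ^ r)) (l : Fin n) :
    wEnt n (L.map AOWConstraint.toClause) (opos₁ f) (opos₂ f) (oposLast f) (posS f) x y l =
      oddTensor L (univ.image f) f (finFunctionFinEquiv.symm x) (finFunctionFinEquiv.symm y) l := by
  rw [wEnt, oddTensor, List.map_map]
  congr 1
  refine List.map_congr_left fun C _ => ?_
  rw [Function.comp_apply, oddEntry, opos₁, opos₂, oposLast, posS, idxL_toClause, idxL_toClause,
    sgnL_toClause C f hf, varAt_toClause]
  have h1 : ((finFunctionFinEquiv (C.1 ∘ fun t => oddFst f t) : ℕ) = x) ↔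
      finFunctionFinEquiv.symm x = C.1 ∘ oddFst f := by
    rw [Equiv.symm_apply_eq, eq_comm, Fin.ext_iff]
  have h2 : ((finFunctionFinEquiv (C.1 ∘ fun t => oddSnd f t) : ℕ) = y) ↔
      finFunctionFinEquiv.symm y = C.1 ∘ oddSnd f := by
    rw [Equiv.symm_apply_eq, eq_comm, Fin.ext_iff]
  have h3 : ((C.1 (oddLast f) : ℕ) = l) ↔ l = C.1 (oddLast f) := by
    rw [eq_comm, Fin.ext_iff]
  simp only [h1, h2, h3]

/-- The pair decoding of a row index: `ρ ↦ (ρ / N, ρ % N)` composed with `finFunctionFinEquiv⁻¹`. [folklore] -/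
def pairDecode (n r : ℕ) : Fin (n ^ r * n ^ r) ≃ (Fin r → Fin n) × (Fin r → Fin n) :=
  finProdFinEquiv.symm.trans (Equiv.prodCongr finFunctionFinEquiv.symm finFunctionFinEquiv.symm)

/-- Components of the pair decoding. [folklore] -/
theorem pairDecode_fst (n r : ℕ) (ρ : Fin (n ^ r * n ^ r)) :
    (pairDecode n r ρ).1 = finFunctionFinEquiv.symm ρ.divNat := rfl

/-- Components of the pair decoding. [folklore] -/
theorem pairDecode_snd (n r : ℕ) (ρ : Fin (n ^ r * n ^ r)) :
    (pairDecode n r ρ).2 = finFunctionFinEquiv.symm ρ.modNat := rfl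

/-- **The program's odd matrix is the re-indexed odd matrix.** [Allen–O'Donnell–Witmer 2015, App. A.2 (A-def)] [folklore] -/
theorem toMat_aMat (L : List (AOWConstraint k n)) (f : Fin (r + r + 1) → Fin k) (hf : Function.Injective f) :
    toMat (n ^ r * n ^ r) (n ^ r * n ^ r)
        (aMat n r (L.map AOWConstraint.toClause) (opos₁ f) (opos₂ f) (oposLast f) (posS f)) =
      (oddMatrix (oddTensor L (univ.image f) f)).submatrix (pairDecode n r) (pairDecode n r) := by
  rw [aMat, toMat_tab]
  funext ρ κ
  rw [Matrix.submatrix_apply, oddMatrix, Matrix.of_apply, pairDecode_fst, pairDecode_snd, pairDecode_fst,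
    pairDecode_snd, aEnt, ← Fin.coe_divNat ρ, ← Fin.coe_modNat ρ, ← Fin.coe_divNat κ, ← Fin.coe_modNat κ]
  have hcond : ((ρ.divNat : ℕ) = ρ.modNat ∧ (κ.divNat : ℕ) = κ.modNat) ↔
      (finFunctionFinEquiv.symm ρ.divNat = (finFunctionFinEquiv.symm ρ.modNat : Fin r → Fin n) ∧
        finFunctionFinEquiv.symm κ.divNat = (finFunctionFinEquiv.symm κ.modNat : Fin r → Fin n)) := by
    rw [Equiv.apply_eq_iff_eq, Equiv.apply_eq_iff_eq, Fin.ext_iff, Fin.ext_iff]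
  by_cases h : (ρ.divNat : ℕ) = ρ.modNat ∧ (κ.divNat : ℕ) = κ.modNat
  · rw [if_pos h, if_pos (hcond.1 h)]
  · rw [if_neg h, if_neg (fun h' => h (hcond.2 h')), sumRange_eq_sum]
    refine Finset.sum_congr rfl fun l _ => ?_
    rw [wEnt_eq L f hf, wEnt_eq L f hf]

/-- **The program's sum of squares is `∑ w²`.** [folklore] -/
theorem sqSumP_eq (L : List (AOWConstraint k n)) (f : Fin (r + r + 1) → Fin k) (hf : Function.Injective f) :
    sqSumP n r (L.map AOWConstraint.toClause) (opos₁ f) (opos₂ f) (oposLast f) (posS f) =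
      ∑ i, ∑ i', ∑ l, oddTensor L (univ.image f) f i i' l ^ 2 := by
  rw [sqSumP, sumRange_eq_sum]
  rw [← Fintype.sum_equiv finFunctionFinEquiv.symm _ _ (fun _ => rfl)]
  refine Finset.sum_congr rfl fun x _ => ?_
  rw [sumRange_eq_sum, ← Fintype.sum_equiv finFunctionFinEquiv.symm _ _ (fun _ => rfl)]
  refine Finset.sum_congr rfl fun y _ => ?_
  rw [sumRange_eq_sum]
  refine Finset.sum_congr rfl fun l _ => ?_
  rw [wEnt_eq L f hf]

/-- **The program's odd test is `OddCheck`.** [Allen–O'Donnell–Witmer 2015, App. A.2/A.4] [cite: arXiv150504383, App. A.2] -/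
theorem oddCheckP_iff (L : List (AOWConstraint k n)) (f : Fin (r + r + 1) → Fin k) (hf : Function.Injective f)
    (j : ℕ) :
    OddCheckP k n r (2 ^ j) L.length (L.map AOWConstraint.toClause) (opos₁ f) (opos₂ f) (oposLast f) (posS f) ↔
      OddCheck k n j L f := by
  unfold OddCheckP OddCheck oddTraceP
  rw [traceL_powL_gramL, toMat_aMat L f hf, trace_pow_gram_submatrix, sqSumP_eq L f hf]

end Odd

/-! ### The whole test and the refuter -/

/-- **The program's acceptance predicate** (the finite conjunction of `AOWAccepts` over the same
index sets, each conjunct the program's test). [cite: arXiv150504383, Thm. 2.3] -/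
def AcceptsP (k n q : ℕ) (cs : List (Clause ℕ)) : Prop :=
  (∀ a b : Fin (k + 1), IsBalancedShape k a b →
      ∀ g : Fin (a + b) → Fin k, Function.Injective g →
        LevelCheckP k n a b q cs.length cs (pos₁ g) (pos₂ g) (posS g)) ∧
    ∀ g : Fin (k / 2 + k / 2 + 1) → Fin k, Function.Injective g →
      OddCheckP k n (k / 2) q cs.length cs (opos₁ g) (opos₂ g) (oposLast g) (posS g)

/-- `AcceptsP` is decidable. [folklore] -/
instance (k n q : ℕ) (cs : List (Clause ℕ)) : Decidable (AcceptsP k n q cs) := by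
  unfold AcceptsP; infer_instance

/-- **The program's test is `AOWAccepts`.** [cite: arXiv150504383, Thm. 2.3] -/
theorem acceptsP_iff (k n j : ℕ) (L : List (AOWConstraint k n)) :
    AcceptsP k n (2 ^ j) (L.map AOWConstraint.toClause) ↔ AOWAccepts k n j L := by
  unfold AcceptsP AOWAccepts
  rw [List.length_map]
  exact and_congr (forall_congr' fun a => forall_congr' fun b => forall_congr' fun _ =>
      forall_congr' fun g => forall_congr' fun hg => levelCheckP_iff L g hg j)
    (forall_congr' fun g => forall_congr' fun hg => oddCheckP_iff L g hg j)

/-- **The refuter as a program** on `(n, φ)`. [cite: arXiv150504383, Thm. 2.3] -/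
def refuteP (k : ℕ) (p : ℕ × CNF ℕ) : Bool :=
  decide (AcceptsP k p.1 (2 ^ aowTraceExp k p.1) (parseL k p.1 p.2))

/-- **The program IS the refuter**: `refuteP k (n, φ) = aowRefute k n φ`. [cite: arXiv150504383, Thm. 2.3] -/
theorem refuteP_eq_aowRefute (k n : ℕ) (φ : CNF ℕ) : refuteP k (n, φ) = aowRefute k n φ := by
  rw [refuteP, aowRefute, Bool.eq_iff_iff, decide_eq_true_iff, decide_eq_true_iff]
  dsimp only
  rw [parseL_eq, acceptsP_iff]

end AOWProg

end Literature.Computability.Complexity
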